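import Literature.Computability.QuantumComplexity.AKSMachineSteps
import HarnessLib

/-!
# The AKS machine, IV: the primality test as an `FP` string function (AKS 2004, Thm 5.1)

Assembly of the AKS algorithm `AKS.aksDecide` (`Literature/NumberTheory/Primality/AKSAlgorithm.lean`,
[AKS04, §4]) in the `FP` string algebra, on top of `AKSMachineSteps.lean` (steps 1–4 and the order
`rFn`) and `AKSMachinePow.lean` (`congrFn`, the test of step 5 for one `a`):

* `ctxFn U = pctx pad n r` (the context of the polynomial arithmetic, `r = leastR n L R`) and
  `allCongrFn` — step 5: `[∀ a < r, a = 0 ∨ congrTest n r a]`, an `allIdxFn` of `congrFn`;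
* `aksCoreFn` — the steps chained by one-bit branches in the order of `AKS.aksDecide`
  (`aksCoreFn_uOf : aksCoreFn (uOf n) = [aksDecide n]`);
* **`aksFn`** with **`aksFn_mem_FP`**, **`aksFn_encodeNat : aksFn (encodeNat n) = [aksDecide n]`** and
  `aksFn_of_ne : aksFn w = [false]` off the canonical numerals — whence, with
  `AKS.aksDecide_eq_true_iff` (Thm 4.1), the running-time theorem [AKS04, Thm 5.1] in the form
  the class `P` of the tree needs (`FactoringPrimesProofs.lean`: `PRIMES_mem_P_holds`).

## References

* [AKS04] M. Agrawal, N. Kayal, N. Saxena, *PRIMES is in P*, Ann. of Math. 160 (2004) 781–793,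
  §4 (the algorithm), Thm 5.1 (polynomial running time).
* S. Arora, B. Barak, *Computational Complexity: A Modern Approach*, CUP 2009, §1.3.
-/

namespace Literature.Computability.QuantumComplexity

open _root_.Computability Complexity Complexity.Brick Polynomial
open Literature.NumberTheory.Primality Literature.Computability.Cryptography

namespace AKSMachine

/-! ### Step 5 over all `a < r` -/

/-- On `⟨ctx, 1ᵃ⟩`: the bit `[a = 0 ∨ congrTest n r a]`. [cite: AgrawalKayalSaxena2004, §4 (step 5)] -/
noncomputable def congrTestA : List Bool → List Bool :=
  orFn (isNilFn ∘ sndF) (congrFn ∘ fanoutFn fstF (lenBinF ∘ sndF))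

/-- `congrTestA` is in `FP` (composition of bricks). [folklore] -/
theorem congrTestA_mem_FP : congrTestA ∈ FP :=
  orFn_mem_FP (comp_mem_FP isNilFn_mem_FP sndF_mem_FP) (comp_mem_FP congrFn_mem_FP (fanoutFn_mem_FP fstF_mem_FP (comp_mem_FP lenBinF_mem_FP sndF_mem_FP)))

/-- `oneBit_congrTestA` (auxiliary; see the module docstring). [folklore] -/
theorem oneBit_congrTestA : OneBit congrTestA := oneBit_orFn (oneBit_isNilFn.comp _) (oneBit_congrFn.comp _)

/-- The context built from `U` and the order found: `pctx pad n r`. [folklore] -/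
noncomputable def ctxFn : List Bool → List Bool := fanoutFn fstF (fanoutFn sndF rFn)

/-- `ctxFn` is in `FP` (composition of bricks). [folklore] -/
theorem ctxFn_mem_FP : ctxFn ∈ FP := fanoutFn_mem_FP fstF_mem_FP (fanoutFn_mem_FP sndF_mem_FP rFn_mem_FP)

/-- `ctxFn_apply` (auxiliary; see the module docstring). [folklore] -/
theorem ctxFn_apply {n : ℕ} (hn : 2 ≤ n) :
    ctxFn (uOf n) = pctx (ones (AKS.rBound n.size * (n.size + 1))) n (AKS.leastR n n.size (AKS.rBound n.size)) := by
  rw [ctxFn, fanoutFn_apply, fanoutFn_apply, rFn_apply hn, uOf, fstF_boolPair, sndF_boolPair, pctx]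

/-- **Step 5**: `allCongrFn U = [∀ a < r, a = 0 ∨ congrTest n r a]`. [cite: AgrawalKayalSaxena2004, §4 (step 5)] -/
noncomputable def allCongrFn : List Bool → List Bool :=
  allIdxFn (binToUnaryFn ∘ fanoutFn id cR) congrTestA ∘ ctxFn

/-- `allCongrFn` is in `FP` (composition of bricks). [folklore] -/
theorem allCongrFn_mem_FP : allCongrFn ∈ FP :=
  comp_mem_FP (allIdxFn_mem_FP (comp_mem_FP binToUnaryFn_mem_FP (fanoutFn_mem_FP OracleCompose.id_mem_FP cR_mem_FP))
    congrTestA_mem_FP oneBit_congrTestA) ctxFn_mem_FP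

/-- `oneBit_allCongrFn` (auxiliary; see the module docstring). [folklore] -/
theorem oneBit_allCongrFn : OneBit allCongrFn :=
  (oneBit_allIdxFn oneBit_congrTestA fun u => by
    rw [Function.comp_apply, fanoutFn_apply]; exact length_binToUnaryFn_boolPair_le _ _).comp _

/-- `allCongrFn_apply` (auxiliary; see the module docstring). [folklore] -/
theorem allCongrFn_apply {n : ℕ} (hn : 2 ≤ n) :
    allCongrFn (uOf n) = [(List.range (AKS.leastR n n.size (AKS.rBound n.size))).all fun a =>
      a == 0 || AKS.congrTest n (AKS.leastR n n.size (AKS.rBound n.size)) a] := by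
  generalize hL : n.size = L
  generalize hR : AKS.rBound L = R
  generalize hr : AKS.leastR n L R = r
  obtain ⟨hr2, hrR, -⟩ := AKS.leastR_le_rBound hn (Nat.lt_size_self n)
  rw [hL, hR, hr] at hr2 hrR
  have hn0 : 0 < n := by omega
  have hpad : r * ((encodeNat n).length + 1) ≤ (ones (R * (L + 1))).length := by
    rw [TM2Pass.length_encodeNat_eq_size, List.length_replicate, hL]; exact Nat.mul_le_mul_right _ hrR
  have hrctx : r ≤ (pctx (ones (R * (L + 1))) n r).length := by rw [length_pctx, List.length_replicate]; nlinarith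
  have hh : (binToUnaryFn ∘ fanoutFn id cR) (pctx (ones (R * (L + 1))) n r) = ones r := by
    rw [Function.comp_apply, fanoutFn_apply, binToUnaryFn_boolPair, id, cR_pctx, bitsToNat_encodeNat, min_eq_left hrctx]
  have hctx : ctxFn (uOf n) = pctx (ones (R * (L + 1))) n r := by rw [ctxFn_apply hn, hL, hR, hr]
  rw [allCongrFn, Function.comp_apply, hctx, allIdxFn_apply oneBit_congrTestA (by rw [hh, List.length_replicate]; exact hrctx),
    hh, List.length_replicate]
  have hpieces : ∀ a, congrTestA (boolPair (pctx (ones (R * (L + 1))) n r) (ones a)) =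
      [decide (a = 0 ∨ AKS.congrTest n r a = true)] := by
    intro a
    have h1 : (isNilFn ∘ sndF) (boolPair (pctx (ones (R * (L + 1))) n r) (ones a)) = [decide (a = 0)] := by
      cases a <;> simp [isNilFn, List.replicate_succ]
    have h2 : (congrFn ∘ fanoutFn fstF (lenBinF ∘ sndF)) (boolPair (pctx (ones (R * (L + 1))) n r) (ones a)) =
        [AKS.congrTest n r a] := by
      simp only [Function.comp_apply, fanoutFn_apply, fstF_boolPair, sndF_boolPair, lenBinF_apply, List.length_replicate]
      exact congrFn_apply _ hn0 hpad a
    rw [congrTestA, orFn_apply h1 h2]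
    by_cases ha : a = 0 <;> simp [ha]
  simp only [hpieces, List.cons.injEq, and_true]
  rw [Bool.eq_iff_iff]
  simp only [decide_eq_true_eq, List.all_eq_true, List.mem_range, Bool.or_eq_true, beq_iff_eq]

/-! ### The assembled test -/

/-- **The AKS decision procedure on the padded record** (steps in the order of `AKS.aksDecide`).
[cite: AgrawalKayalSaxena2004, §4 (Algorithm for Primality Testing)] -/
noncomputable def aksCoreFn : List Bool → List Bool :=
  iteFn (ltFn ∘ fanoutFn sndF fun _ => encodeNat 2) (fun _ => [false])
    (iteFn noFactorFn
      (iteFn nLeRFn (fun _ => [true]) (iteFn ppBitFn (fun _ => [false]) allCongrFn))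
      fun _ => [false])

/-- `aksCoreFn` is in `FP` (composition of bricks). [folklore] -/
theorem aksCoreFn_mem_FP : aksCoreFn ∈ FP :=
  iteFn_mem_FP (comp_mem_FP ltFn_mem_FP (fanoutFn_mem_FP sndF_mem_FP (const_mem_FP _))) (const_mem_FP _)
    (iteFn_mem_FP noFactorFn_mem_FP
      (iteFn_mem_FP nLeRFn_mem_FP (const_mem_FP _) (iteFn_mem_FP ppBitFn_mem_FP (const_mem_FP _) allCongrFn_mem_FP))
      (const_mem_FP _))

/-- **The machine decides like `AKS.aksDecide`** on the padded record of `n`. [cite: AgrawalKayalSaxena2004, Thm 4.1 and Thm 5.1] -/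
theorem aksCoreFn_uOf (n : ℕ) : aksCoreFn (uOf n) = [AKS.aksDecide n] := by
  have h1 : (ltFn ∘ fanoutFn sndF fun _ => encodeNat 2) (uOf n) = [decide (n < 2)] := by simp [uOf]
  rw [aksCoreFn, iteFn_apply h1, AKS.aksDecide]
  by_cases hn2 : n < 2
  · simp [hn2]
  have hn : 2 ≤ n := by omega
  rw [if_neg (by simpa using hn2), if_neg hn2,
    iteFn_apply (noFactorFn_apply n)]
  by_cases hfac : AKS.HasFactorLe n (AKS.rBound n.size)
  · simp [hfac]
  rw [if_pos (by simpa using hfac), if_neg hfac, iteFn_apply (nLeRFn_apply n)]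
  by_cases hle : n ≤ AKS.rBound n.size
  · simp [hle]
  rw [if_neg (by simpa using hle), if_neg hle, iteFn_apply (ppBitFn_apply hn)]
  by_cases hpp : AKS.IsPerfectPower n
  · simp [hpp]
  rw [if_neg (by simpa using hpp), if_neg hpp, allCongrFn_apply hn]

/-- **The AKS test as a string function**: reject strings that are not canonical numerals, otherwise run
`aksCoreFn` on the padded record. [cite: AgrawalKayalSaxena2004, §4] -/
noncomputable def aksFn : List Bool → List Bool :=
  iteFn (eqPairFn ∘ fanoutFn id norm) (aksCoreFn ∘ mkU) fun _ => [false]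

/-- **`aksFn ∈ FP`: the AKS test runs in polynomial time on Mathlib's TM2 model.**
[cite: AgrawalKayalSaxena2004, Thm 5.1] -/
theorem aksFn_mem_FP : aksFn ∈ FP :=
  iteFn_mem_FP (comp_mem_FP eqPairFn_mem_FP (fanoutFn_mem_FP OracleCompose.id_mem_FP norm_mem_FP))
    (comp_mem_FP aksCoreFn_mem_FP mkU_mem_FP) (const_mem_FP _)

/-- **On a canonical numeral the machine answers `aksDecide`.** [cite: AgrawalKayalSaxena2004, Thm 4.1 and Thm 5.1] -/
theorem aksFn_encodeNat (n : ℕ) : aksFn (encodeNat n) = [AKS.aksDecide n] := by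
  have hc : (eqPairFn ∘ fanoutFn id norm) (encodeNat n) = [true] := by
    simp [norm_eq_encodeNat, eqPairFn_boolPair]
  rw [aksFn, iteFn_apply hc, if_pos rfl, Function.comp_apply, mkU_encodeNat, aksCoreFn_uOf]

/-- **Off the canonical numerals the machine answers `0`.** [folklore] -/
theorem aksFn_of_ne {w : List Bool} (hw : encodeNat (bitsToNat w) ≠ w) : aksFn w = [false] := by
  have hc : (eqPairFn ∘ fanoutFn id norm) w = [false] := by
    simp [norm_eq_encodeNat, eqPairFn_boolPair, Ne.symm hw]
  rw [aksFn, iteFn_apply hc]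
  simp

end AKSMachine

end Literature.Computability.QuantumComplexity
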